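import Summits.BirchSwinnertonDyer.BirchSwinnertonDyer.Theorems.ResidualThetaTransportAtTwoThetaLayerLambdaCongruenceAtTwoQuiverCycleSpace
import Summits.BirchSwinnertonDyer.BirchSwinnertonDyer.Theorems.ResidualThetaTransportAtTwoThetaLayerLambdaCongruenceAtTwoLatticeModP
import Mathlib.LinearAlgebra.Dimension.Localization
import HarnessLib

/-!
# Crux `ThetaLayerLambdaCongruenceAtTwo` (stmt-BirchSwinnertonDyer-20688, route ResidualThetaTransportAtTwo), line
# `birth` v9, plan ITEM B1' (lead rtt-p3 g3): the INTEGRAL cokernel of the coboundary of a finite connected quiver is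
# TORSION-FREE — `p·M ∈ im δ_ℤ ⇒ M ∈ im δ_ℤ` for every prime `p` (width seat bsd-wall-rtt-p3-w3 g2;
# `--supports stmt-BirchSwinnertonDyer-20688 --as helper`; closes nothing)

HONEST FRAMING. Generic linear algebra (no definition, no instance); nothing about any curve or form is asserted; BSD is
not proved by any of this.

WHAT. The lead's B1' reads: «the integral Manin-symbol module `ℤ^X/(Rel_ℤ + ⟨S-fixed⟩ + ⟨τ-fixed⟩) = coker(δ : C⁰(G') →
C¹(G'))` is torsion-free (spanning tree)». This file proves the quiver statement with NO spanning tree: combine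
`quiver_rank_incidence_add_one` (rank of the incidence matrix is `#V − 1` over EVERY field, `…QuiverCycleSpace`) with
`mem_of_prime_smul_mem_of_finrank_modP_eq` (a sublattice with full rank mod `p` is `p`-saturated, `…LatticeModP`):
* `quiver_ker_coboundary_int_eq_span_one` — over `ℤ`, `ker δ_ℤ = ℤ·𝟙`;
* `quiver_finrank_range_coboundary_int_add_one` — `rank_ℤ (im δ_ℤ) + 1 = #V` (rank–nullity over the domain `ℤ`);
* `quiver_span_modP_range_coboundary_int` — the `𝔽_p`-span of `im δ_ℤ mod p` is `im δ_{𝔽_p}`;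
* **`quiver_mem_range_coboundary_int_of_prime_smul_mem`** — `p·M ∈ im δ_ℤ ⇒ M ∈ im δ_ℤ`.

References: [Manin1972] Thm. 1.9 (where it is used); J.-P. Serre, Trees, §I.2.
-/

-- justification: the `Summit.BirchSwinnertonDyer.BirchSwinnertonDyer.…` path repeats a component (route-file convention)
set_option linter.dupNamespace false

namespace Summit.BirchSwinnertonDyer.BirchSwinnertonDyer.Theorems.ThetaLayerLambdaCongruenceAtTwo

section QuiverInt

variable {E V : Type*} [Fintype E] [Fintype V] [DecidableEq V] (s t : E → V)

omit [Fintype E] in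
/-- Integral coboundary: `(Bᵀ f)(e) = f(t e) − f(s e)` over any commutative ring. [folklore] -/
theorem quiver_transpose_mulVec_apply_ring {R : Type*} [CommRing R] (f : V → R) (e : E) :
    (Matrix.of (fun (v : V) (e : E) ↦ ((if t e = v then (1 : R) else 0) - (if s e = v then (1 : R) else 0)))).transpose.mulVec
      f e = f (t e) - f (s e) := by
  simp only [Matrix.mulVec, dotProduct, Matrix.transpose_apply, Matrix.of_apply, sub_mul, Finset.sum_sub_distrib,
    ite_mul, one_mul, zero_mul, Finset.sum_ite_eq, Finset.mem_univ, if_true]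

omit [Fintype E] in
/-- Over `ℤ`: `ker δ_ℤ = ℤ·𝟙` on a connected quiver. [folklore] -/
theorem quiver_ker_coboundary_int_eq_span_one
    (hconn : ∀ v w : V, Relation.EqvGen (fun a b ↦ ∃ e, s e = a ∧ t e = b) v w) :
    LinearMap.ker (Matrix.of (fun (v : V) (e : E) ↦
        ((if t e = v then (1 : ℤ) else 0) - (if s e = v then (1 : ℤ) else 0)))).transpose.mulVecLin =
      ℤ ∙ (fun _ : V ↦ (1 : ℤ)) := by
  ext f
  rw [LinearMap.mem_ker, Submodule.mem_span_singleton, Matrix.mulVecLin_apply]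
  constructor
  · intro hf
    have hf' : ∀ e, f (t e) = f (s e) := fun e ↦ by
      have := congrFun hf e
      rw [quiver_transpose_mulVec_apply_ring, Pi.zero_apply] at this
      exact sub_eq_zero.mp this
    rcases isEmpty_or_nonempty V with hV | ⟨⟨v₀⟩⟩
    · exact ⟨0, funext fun v ↦ (hV.false v).elim⟩
    · refine ⟨f v₀, funext fun v ↦ ?_⟩
      rw [Pi.smul_apply, smul_eq_mul, mul_one]
      exact quiver_eq_of_forall_apply_eq s t hconn f hf' v₀ v
  · rintro ⟨a, rfl⟩
    funext e
    rw [quiver_transpose_mulVec_apply_ring, Pi.zero_apply, Pi.smul_apply, Pi.smul_apply, sub_self]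

omit [Fintype E] in
/-- **`rank_ℤ (im δ_ℤ) + 1 = #V`** for a connected quiver with a vertex (rank–nullity over the domain `ℤ`).
[folklore] -/
theorem quiver_finrank_range_coboundary_int_add_one [Nonempty V]
    (hconn : ∀ v w : V, Relation.EqvGen (fun a b ↦ ∃ e, s e = a ∧ t e = b) v w) :
    Module.finrank ℤ (LinearMap.range (Matrix.of (fun (v : V) (e : E) ↦
        ((if t e = v then (1 : ℤ) else 0) - (if s e = v then (1 : ℤ) else 0)))).transpose.mulVecLin) + 1 =
      Fintype.card V := by
  have h := Submodule.finrank_quotient_add_finrank (LinearMap.ker (Matrix.of (fun (v : V) (e : E) ↦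
        ((if t e = v then (1 : ℤ) else 0) - (if s e = v then (1 : ℤ) else 0)))).transpose.mulVecLin)
  rw [LinearEquiv.finrank_eq (LinearMap.quotKerEquivRange _), Module.finrank_fintype_fun_eq_card,
    quiver_ker_coboundary_int_eq_span_one s t hconn] at h
  have h1 : Module.finrank ℤ (ℤ ∙ (fun _ : V ↦ (1 : ℤ))) = 1 := by
    have hne : (fun _ : V ↦ (1 : ℤ)) ≠ 0 := fun h0 ↦ one_ne_zero (congrFun h0 (Classical.arbitrary V))
    rw [← (LinearEquiv.toSpanNonzeroSingleton ℤ (V → ℤ) _ hne).finrank_eq, Module.finrank_self]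
  rw [h1] at h
  exact h

omit [Fintype E] in
/-- **The `𝔽_p`-span of `(im δ_ℤ) mod p` is `im δ_{𝔽_p}`** (lift `𝔽_p`-valued potentials to `ℤ`). [folklore] -/
theorem quiver_span_modP_range_coboundary_int {p : ℕ} [Fact p.Prime] :
    Submodule.span (ZMod p) ((fun x : E → ℤ ↦ (fun i ↦ ((x i : ℤ) : ZMod p))) ''
      (LinearMap.range (Matrix.of (fun (v : V) (e : E) ↦
        ((if t e = v then (1 : ℤ) else 0) - (if s e = v then (1 : ℤ) else 0)))).transpose.mulVecLin :
          Set (E → ℤ))) =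
      LinearMap.range (Matrix.of (fun (v : V) (e : E) ↦
        ((if t e = v then (1 : ZMod p) else 0) - (if s e = v then (1 : ZMod p) else 0)))).transpose.mulVecLin := by
  apply le_antisymm
  · rw [Submodule.span_le]
    rintro _ ⟨x, ⟨f, rfl⟩, rfl⟩
    refine ⟨fun v ↦ ((f v : ℤ) : ZMod p), ?_⟩
    funext e
    simp only [Matrix.mulVecLin_apply, quiver_transpose_mulVec_apply_ring, Int.cast_sub]
  · rintro _ ⟨g, rfl⟩
    refine Submodule.subset_span ⟨_, ⟨fun v ↦ ((g v).cast : ℤ), rfl⟩, ?_⟩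
    funext e
    simp only [Matrix.mulVecLin_apply, quiver_transpose_mulVec_apply_ring, Int.cast_sub, ZMod.intCast_cast,
      ZMod.cast_id', id_eq]

/-- **THE INTEGRAL COKERNEL OF THE COBOUNDARY OF A FINITE CONNECTED QUIVER IS TORSION-FREE**: for every prime `p` and
`M : E → ℤ`, `p·M ∈ im δ_ℤ ⇒ M ∈ im δ_ℤ`. Proof: `rank_{𝔽_p} im δ_{𝔽_p} = #V − 1 = rank_ℤ im δ_ℤ`
(`quiver_rank_incidence_add_one`, `quiver_finrank_range_coboundary_int_add_one`) and a sublattice with full rank mod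
`p` is `p`-saturated (`mem_of_prime_smul_mem_of_finrank_modP_eq`). No spanning tree.
[folklore; cite: Manin1972, Thm. 1.9 (where it is used)] -/
theorem quiver_mem_range_coboundary_int_of_prime_smul_mem [Nonempty V]
    (hconn : ∀ v w : V, Relation.EqvGen (fun a b ↦ ∃ e, s e = a ∧ t e = b) v w) {p : ℕ} [Fact p.Prime]
    {M : E → ℤ} (hM : (p : ℤ) • M ∈ LinearMap.range (Matrix.of (fun (v : V) (e : E) ↦
        ((if t e = v then (1 : ℤ) else 0) - (if s e = v then (1 : ℤ) else 0)))).transpose.mulVecLin) :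
    M ∈ LinearMap.range (Matrix.of (fun (v : V) (e : E) ↦
        ((if t e = v then (1 : ℤ) else 0) - (if s e = v then (1 : ℤ) else 0)))).transpose.mulVecLin := by
  refine mem_of_prime_smul_mem_of_finrank_modP_eq (p := p) _ ?_ hM
  rw [quiver_span_modP_range_coboundary_int s t]
  have h1 := quiver_finrank_range_coboundary_int_add_one s t hconn
  have h2 : Module.finrank (ZMod p) (LinearMap.range (Matrix.of (fun (v : V) (e : E) ↦
      ((if t e = v then (1 : ZMod p) else 0) - (if s e = v then (1 : ZMod p) else 0)))).transpose.mulVecLin) + 1 =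
      Fintype.card V := by
    have h := quiver_rank_incidence_add_one (k := ZMod p) s t hconn
    rw [← Matrix.rank_transpose, Matrix.rank] at h
    exact h
  omega

end QuiverInt

end Summit.BirchSwinnertonDyer.BirchSwinnertonDyer.Theorems.ThetaLayerLambdaCongruenceAtTwo
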